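import Mathlib
import Summits.Ventures.PercRepro.TriangleCapRegularCellNine

/-!
# PercRepro — THE REGULAR CELL `t = 12 D`: THE BLOCKS, PART A (p3, gen 57)

The row-size lists realising the excess values (rows of `12`, `24` or `36` edges), part A.  Axioms: standard.
-/

namespace PercRepro

namespace TriangleCap

namespace C047

open Finset

/-- The blocks, range `11 ≤ e ≤ 79`. -/
def blockTwelveA (e : ℕ) : List ℕ :=
  if e = 11 then [11, 1]
  else if e = 20 then [10, 2]
  else if e = 21 then [10, 1, 1]
  else if e = 22 then [11, 11, 1, 1]
  else if e = 27 then [9, 3]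
  else if e = 29 then [9, 2, 1]
  else if e = 30 then [9, 1, 1, 1]
  else if e = 31 then [11, 10, 2, 1]
  else if e = 32 then [8, 4]
  else if e = 33 then [11, 11, 11, 1, 1, 1]
  else if e = 35 then [7, 5]
  else if e = 36 then [6, 6]
  else if e = 37 then [8, 2, 1, 1]
  else if e = 38 then [8, 1, 1, 1, 1]
  else if e = 39 then [7, 4, 1]
  else if e = 40 then [10, 10, 2, 2]
  else if e = 41 then [6, 5, 1]
  else if e = 42 then [7, 3, 1, 1]
  else if e = 43 then [7, 2, 2, 1]
  else if e = 44 then [6, 4, 2]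
  else if e = 45 then [5, 5, 2]
  else if e = 46 then [5, 5, 1, 1]
  else if e = 47 then [5, 4, 3]
  else if e = 48 then [4, 4, 4]
  else if e = 49 then [5, 4, 2, 1]
  else if e = 50 then [5, 3, 3, 1]
  else if e = 51 then [4, 4, 3, 1]
  else if e = 52 then [4, 4, 2, 2]
  else if e = 53 then [4, 3, 3, 2]
  else if e = 54 then [3, 3, 3, 3]
  else if e = 55 then [4, 3, 2, 2, 1]
  else if e = 56 then [3, 3, 3, 2, 1]
  else if e = 57 then [3, 3, 2, 2, 2]
  else if e = 58 then [3, 3, 2, 2, 1, 1]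
  else if e = 59 then [3, 2, 2, 2, 2, 1]
  else if e = 60 then [2, 2, 2, 2, 2, 2]
  else if e = 61 then [2, 2, 2, 2, 2, 1, 1]
  else if e = 62 then [2, 2, 2, 2, 1, 1, 1, 1]
  else if e = 63 then [2, 2, 2, 1, 1, 1, 1, 1, 1]
  else if e = 64 then [2, 2, 1, 1, 1, 1, 1, 1, 1, 1]
  else if e = 65 then [2, 1, 1, 1, 1, 1, 1, 1, 1, 1, 1]
  else if e = 66 then [1, 1, 1, 1, 1, 1, 1, 1, 1, 1, 1, 1]
  else if e = 67 then [8, 7, 5, 4]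
  else if e = 68 then [8, 6, 6, 4]
  else if e = 69 then [7, 7, 6, 4]
  else if e = 70 then [7, 7, 5, 5]
  else if e = 71 then [7, 6, 6, 5]
  else if e = 72 then [6, 6, 6, 6]
  else if e = 73 then [7, 7, 6, 2, 2]
  else if e = 74 then [7, 7, 5, 4, 1]
  else if e = 75 then [7, 6, 6, 4, 1]
  else if e = 76 then [7, 6, 5, 5, 1]
  else if e = 77 then [6, 6, 6, 5, 1]
  else if e = 78 then [7, 7, 4, 3, 3]
  else [7, 6, 5, 4, 2]


end C047

end TriangleCap

end PercRepro
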